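import Literature.AlgebraicGeometry.Modules.CechProductCoverUnitKunneth
import Literature.AlgebraicGeometry.Modules.CechProductCoverCrossCup
import Literature.AlgebraicGeometry.Modules.CechPullbackSystemHom
import Literature.AlgebraicGeometry.Modules.CechUnitModulePairing
import Literature.Algebra.Homology.OrderedCechPairSystemKunneth
import Literature.Algebra.Homology.OrderedCechSystemCupClasses
import Literature.Algebra.Homology.OrderedCechSystemRefineMap
import Literature.Algebra.Homology.KunnethDirectSum
import Literature.Algebra.Homology.KunnethComponentsDirectSum
import HarnessLib

/-!
# Künneth on the product cover, T-shape: the Künneth components `y ⊗ z ↦ p^*y ∪ q^*z` of `Ȟⁿ(W, 𝒪_{X ×_S X})` are jointly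
# bijective (The Stacks Project, Tag 0BEC; Görtz–Wedhorn II, Cor. 22.110; Mumford, *Abelian Varieties*, §13)

Layer `Literature/AlgebraicGeometry/Modules`, PROOF file (theorems only; no definition, no instance, no notation, no named fact).
Cell `hodgecm-mathlib` (D-0151), F-11 ∕ J3 Künneth packet, brick **(G3) «Künneth on the product cover», the CLOSER** (F0P1b-p06 (g2),
row handed over by B-p21 (g21)): for a cartesian square `Z = X ×_S Y` over an AFFINE base `S` with `φ : k ≃ Γ(S, 𝒪_S)` (`k` a field),
finite covers `𝓤`, `𝓥` of `X`, `Y` with affine non-empty finite intersections and the product cover `W (i, j) = p⁻¹U_i ∩ q⁻¹V_j` of `Z`,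
the Künneth map
`Φₙ : ⨁_{a+b=n} Ȟᵃ(𝓤, 𝒪_X) ⊗ₖ Ȟᵇ(𝓥, 𝒪_Y) ≅ Hⁿ(Č(𝓤, 𝒪_X) ⊗ Č(𝓥, 𝒪_Y)) → Hⁿ(Č(lexSystem (Γ(𝓤, 𝒪_X) ⊠ Γ(𝓥, 𝒪_Y)))) ≅ Ȟⁿ(W, 𝒪_Z)`
(★ `KunnethDirectSum.kunnethLinearEquiv` ≫ ★ F-K3 `OrderedCechPairSystemKunneth.bijective_homologyMap_tensor_cross` (Alexander–Whitney
cross product) ≫ ★ (B-i′) `CechProductCoverUnitKunneth.exists_sysComplex_lexSystem_prodSystem_iso_cechComplex_unit`) is BIJECTIVE as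
soon as `Ȟⁿ(W, 𝒪_Z)` is finite-dimensional (§1, `bijective_homologyMap_comp_kunnethLinearEquiv`), and on the summand `(a, b)` it is the
Künneth component `y ⊗ z ↦ p^*y ∪ q^*z` (★ (B-ii) `CechProductCoverCrossCup.homologyMap_cechUnit_iso_cross_kunnethComponent_eq_cupH`, B-p06 (g15) ∕ F0P1a-p02 (g3) ∕ F0P1a-p03 (g2)).  ★ B-p21
`KunnethComponentsDirectSum.hinjT_of_injective ∕ hsurjT_of_surjective` then give the **T-shape** consumed by the F-J3b skeleton of
F0P1b-p02 (g2) (stubs `stub_hinjT` ∕ `stub_hsurjT`, there for `X = Y` an abelian variety and `𝓤 = 𝓥`):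

* §1 `bijective_homologyMap_comp_kunnethLinearEquiv` — pure homological algebra: for systems `M`, `N` of `k`-modules on finite index
  types and ANY isomorphism `e : Č(lexSystem (M ⊠ N)) ≅ K` with `Hⁿ(K)` finite over `k`, `Hⁿ(e) ∘ Hⁿ(× ∘ totalTensorIso) ∘ kunnethLinearEquiv`
  is bijective;
* §2 `comp_kunnethLinearEquiv_lof_eq` — the value of such a composite on the summand `(i, j)` is determined by its values on the Künneth
  components of pure tensors of classes (★ `kunnethLinearEquiv_lof`, pure tensors span);
* §3 **`hinjT_productCover`**, **`hsurjT_productCover`** (diagonal setting `Y = X`, `𝓥 = 𝓤`, `iY = iX`, the shape of the F-J3b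
  letters): antidiagonal families `T` with `∑_{a+b=n} c_{a,b} (T (a,b)) = 0` vanish, and every class of `Ȟⁿ(W, 𝒪_Z)` is such a sum, where
  `c_{a,b} = TensorProduct.lift ((cupH μ_W a b n h).compl₁₂ p^* q^*)` (written inline, no definition).

HC_CM is proved only modulo the 7 printed citations until rung 0 closes — nothing here bears on a summit statement.

## References
* [StacksProject] The Stacks Project, Tag 0BEC (Künneth formula for the Čech complex of the product cover over an affine base),
  Tag 01FP (cup product), Tag 01FG (Čech complexes, refinement).
* [GortzWedhorn2023] U. Görtz, T. Wedhorn, *Algebraic Geometry II* (2023), Cor. 22.110 (Künneth formula over a field), Def. 21.68 (p. 180).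
* [Weibel1994] C. A. Weibel, *An introduction to homological algebra* (1994), Thm. 3.6.3 (Künneth formula over a field).
* [MumfordAV1970] D. Mumford, *Abelian Varieties* (1970), §13 Cor. 2 (p. 129) (the cup product `H¹ ⊗ H¹ → H²` via Künneth on `X × X`).
-/

set_option backward.isDefEq.respectTransparency false -- `Scheme.Modules`, `GradedObject` are not reducible (as in ★ `KunnethDirectSum`)

noncomputable section

universe u

open CategoryTheory CategoryTheory.Limits AlgebraicGeometry TopologicalSpace TensorProduct Opposite Finset
open HomologicalComplex
open Literature.Algebra.Homology Literature.Algebra.Homology.OrderedCech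

namespace Literature.AlgebraicGeometry.Modules

/-! ## §1 Bijectivity of the Künneth map through an identification of the lexicographic Čech complex -/

section Algebra

variable {k : Type u} [Field k] {ι κ : Type} [LinearOrder ι] [LinearOrder κ] [Fintype ι] [Fintype κ]
  (M : Finset ι ⥤ ModuleCat.{u} k) (N : Finset κ ⥤ ModuleCat.{u} k) {K : CochainComplex (ModuleCat.{u} k) ℤ}
  (e : sysComplex (lexSystem (prodSystem M N)) ≅ K)

/-- **The Künneth map of the product system through an identification is bijective**: for systems `M`, `N` of vector spaces on
finite index types, bounds `a₁ ≤ · ≤ b₁`, `a₂ ≤ · ≤ b₂` on the two ordered Čech complexes, and any isomorphism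
`e : Č(lexSystem (M ⊠ N)) ≅ K` with `Hⁿ(K)` finite-dimensional, the composite
`⨁_{i+j=n} Hⁱ(Č M) ⊗ Hʲ(Č N) ≃ Hⁿ(Č M ⊗ Č N) → Hⁿ(Č(lexSystem (M ⊠ N))) ≅ Hⁿ(K)` (★ `kunnethLinearEquiv`, then `Hⁿ` of
`totalTensorIso ≫ ×`, then `Hⁿ(e)`) is bijective (★ F-K3 `bijective_homologyMap_tensor_cross`, its finiteness hypothesis transported along
`Hⁿ(e)`). [cite: StacksProject, Tag 0BEC] [cite: Weibel1994, Thm. 3.6.3] [cite: GortzWedhorn2023, Cor. 22.110] -/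
theorem bijective_homologyMap_comp_kunnethLinearEquiv (a₁ b₁ a₂ b₂ : ℤ) [(sysComplex M).IsStrictlyGE a₁] [(sysComplex M).IsStrictlyLE b₁]
    [(sysComplex N).IsStrictlyGE a₂] [(sysComplex N).IsStrictlyLE b₂] (n : ℤ) [Module.Finite k (K.homology n)] :
    Function.Bijective
      ((HomologicalComplex.homologyMap e.hom n).hom ∘ₗ
        (HomologicalComplex.homologyMap ((totalTensorIso M N).hom ≫
          totalDescHom (sysBicomplex (prodSystem M N)) (sysComplex (lexSystem (prodSystem M N)))
            (fun a b n => ModuleCat.ofHom (crossComponent (prodSystem M N) a b n)) (crossComponent_comm (prodSystem M N))) n).hom ∘ₗ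
        (kunnethLinearEquiv (sysComplex M) (sysComplex N) a₁ b₁ a₂ b₂ n).toLinearMap) := by
  -- `Hⁿ(e)` is bijective and transports finiteness
  have h1 : Function.Bijective (HomologicalComplex.homologyMap e.hom n).hom :=
    ((HomologicalComplex.homologyFunctor _ _ n).mapIso e).toLinearEquiv.bijective
  have e' : (sysComplex (lexSystem (prodSystem M N))).homology n ≃ₗ[k] K.homology n :=
    ((HomologicalComplex.homologyFunctor _ _ n).mapIso e).toLinearEquiv
  haveI : Module.Finite k ((sysComplex (lexSystem (prodSystem M N))).homology n) := Module.Finite.equiv e'.symm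
  rw [LinearMap.coe_comp, LinearMap.coe_comp]
  exact h1.comp ((bijective_homologyMap_tensor_cross M N n).comp
    (kunnethLinearEquiv (sysComplex M) (sysComplex N) a₁ b₁ a₂ b₂ n).bijective)

/-! ## §2 The value on a summand from the values on Künneth components -/

omit [Fintype ι] [Fintype κ] in
/-- **A composite through the Künneth equivalence is computed on the summand `(i, j)` by its values on the classes `[y ⊗ z]`**:
if `Ψ : Hⁿ(Č M ⊗ Č N) → H` satisfies `Ψ (κᵢⱼ (y ⊗ z)) = c (y ⊗ z)` for all classes `y`, `z` (`κᵢⱼ` the Künneth component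
`[y] ⊗ [z] ↦ [y ⊗ z]`), then `Ψ ∘ kunnethLinearEquiv` agrees with the linear map `c` on the whole summand `ι_{(i,j)} (Hⁱ ⊗ Hʲ)`
(★ `kunnethLinearEquiv_lof`; pure tensors span). [cite: Weibel1994, Thm. 3.6.3] -/
theorem comp_kunnethLinearEquiv_lof_eq (a₁ b₁ a₂ b₂ : ℤ) [(sysComplex M).IsStrictlyGE a₁] [(sysComplex M).IsStrictlyLE b₁]
    [(sysComplex N).IsStrictlyGE a₂] [(sysComplex N).IsStrictlyLE b₂] (n : ℤ) {H : Type*} [AddCommGroup H] [Module k H]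
    (Ψ : (HomologicalComplex.tensorObj (sysComplex M) (sysComplex N)).homology n →ₗ[k] H)
    (r : {r : ℤ × ℤ // r.1 + r.2 = n}) (c : (sysComplex M).homology r.1.1 ⊗[k] (sysComplex N).homology r.1.2 →ₗ[k] H)
    (hc : ∀ (y : (sysComplex M).homology r.1.1) (z : (sysComplex N).homology r.1.2),
      Ψ ((kunnethComponent (sysComplex M) (sysComplex N) r.1.1 r.1.2 n r.2).hom (y ⊗ₜ[k] z)) = c (y ⊗ₜ[k] z))
    (x : (sysComplex M).homology r.1.1 ⊗[k] (sysComplex N).homology r.1.2) :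
    Ψ (kunnethLinearEquiv (sysComplex M) (sysComplex N) a₁ b₁ a₂ b₂ n
      (DirectSum.lof k _ (TensorSummand (homologyZeroDifferential (sysComplex M)) (homologyZeroDifferential (sysComplex N)) n) r x)) =
      c x := by
  rw [kunnethLinearEquiv_lof]
  change (Ψ ∘ₗ (kunnethComponent (sysComplex M) (sysComplex N) r.1.1 r.1.2 n r.2).hom) x = c x
  congr 1
  apply TensorProduct.ext'
  intro y z
  exact hc y z

end Algebra

/-! ## §3 The T-shape on the product cover (diagonal setting `Y = X`, `𝓥 = 𝓤`) -/

section ProductCover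

variable {X Z S : Scheme.{u}} {p q : Z ⟶ X} {iX : X ⟶ S} {k : Type u} [Field k] [IsAffine S]
  (H : IsPullback p q iX iX) (φ : k ≃+* Γ(S, ⊤))
  {ρX : k →+* Γ(X, ⊤)} {ρZ : k →+* Γ(Z, ⊤)}
  (hρX : ∀ c, ρX c = iX.appTop (φ c)) (hρZp : ∀ c, ρZ c = p.appTop (ρX c)) (hρZq : ∀ c, ρZ c = q.appTop (ρX c))
  {ι : Type} [LinearOrder ι] [Fintype ι] (𝓤 : ι → X.Opens) (hU : ∀ s : Finset ι, s.Nonempty → IsAffineOpen (cechOpen 𝓤 s))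
  (W : ι ×ₗ ι → Z.Opens) (hW : ∀ i j, W (toLex (i, j)) = p ⁻¹ᵁ 𝓤 i ⊓ q ⁻¹ᵁ 𝓤 j)
  (admp : ∀ c, W c ≤ p ⁻¹ᵁ 𝓤 (ofLex c).1) (admq : ∀ c, W c ≤ q ⁻¹ᵁ 𝓤 (ofLex c).2)

include H φ hρX hU hW in
/-- **(G3-inj), T-shape — Künneth INJECTIVITY on the product cover**: for the self-product `Z = X ×_S X` over an affine base with
`φ : k ≃ Γ(S, 𝒪_S)`, a finite cover `𝓤` of `X` with affine non-empty finite intersections, the product cover `W (i, j) = p⁻¹U_i ∩ q⁻¹U_j`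
and `Ȟⁿ(W, 𝒪_Z)` finite-dimensional, an antidiagonal family `T (a, b) ∈ Ȟᵃ(𝓤, 𝒪_X) ⊗ₖ Ȟᵇ(𝓤, 𝒪_X)` with
`∑_{a+b=n} (y ⊗ z ↦ p^*y ∪ q^*z) (T (a, b)) = 0` vanishes identically (★ B-p21 `KunnethComponents.hinjT_of_injective` applied to the bijective
Künneth map of §1 and its values on summands, §2 + (B-ii)).  The letter `stub_hinjT` of the F-J3b skeleton (F0P1b-p02 (g2)).
[cite: StacksProject, Tag 0BEC] [cite: GortzWedhorn2023, Cor. 22.110] [cite: MumfordAV1970, §13 Cor. 2 (p. 129)] -/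
theorem hinjT_productCover (n : ℕ) [Module.Finite k ((cechComplex W (unitModule Z) ρZ).homology (n : ℤ))]
    (T : ∀ r : ℕ × ℕ, (cechComplex 𝓤 (unitModule X) ρX).homology (r.1 : ℤ) ⊗[k] (cechComplex 𝓤 (unitModule X) ρX).homology (r.2 : ℤ))
    (hT : (∑ r ∈ antidiagonal n, if h : r.1 + r.2 = n then
      TensorProduct.lift ((cupH (mulPairing W ρZ) (isNaturalPairing_mulPairing _ _) r.1 r.2 n h).compl₁₂
        ((HomologicalComplex.homologyMap (refineComplexMap (fun c : ι ×ₗ ι => (ofLex c).1)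
          (pullbackSystemHom p 𝓤 W (fun c => (ofLex c).1) admp ρX ρZ hρZp)) (r.1 : ℤ)).hom)
        ((HomologicalComplex.homologyMap (refineComplexMap (fun c : ι ×ₗ ι => (ofLex c).2)
          (pullbackSystemHom q 𝓤 W (fun c => (ofLex c).2) admq ρX ρZ hρZq)) (r.2 : ℤ)).hom)) (T r) else 0) = 0)
    (r : ℕ × ℕ) (hr : r ∈ antidiagonal n) : T r = 0 := by
  classical
  obtain rfl : W = fun c : ι ×ₗ ι => p ⁻¹ᵁ 𝓤 (ofLex c).1 ⊓ q ⁻¹ᵁ 𝓤 (ofLex c).2 := funext fun c => hW (ofLex c).1 (ofLex c).2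
  obtain ⟨e, ε, he, hε⟩ := exists_sysComplex_lexSystem_prodSystem_iso_cechComplex_unit (H := H) (φ := φ) (hρX := hρX)
    (hρY := hρX) (hρZ := hρZp) 𝓤 𝓤 hU hU
  haveI := isStrictlyGE_cechComplex 𝓤 (unitModule X) ρX
  haveI := isStrictlyLE_cechComplex 𝓤 (unitModule X) ρX (Fintype.card ι : ℤ) (by omega)
  have hΦ := bijective_homologyMap_comp_kunnethLinearEquiv (sectionsSystem 𝓤 (unitModule X) ρX)
    (sectionsSystem 𝓤 (unitModule X) ρX) e 0 (Fintype.card ι : ℤ) 0 (Fintype.card ι : ℤ) (n : ℤ)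
  refine KunnethComponents.hinjT_of_injective (HZ := fun i : ℤ => ((cechComplex 𝓤 (unitModule X) ρX).homology i : Type u)) n _
    (fun r h => TensorProduct.lift ((cupH (mulPairing (fun c : ι ×ₗ ι => p ⁻¹ᵁ 𝓤 (ofLex c).1 ⊓ q ⁻¹ᵁ 𝓤 (ofLex c).2) ρZ)
      (isNaturalPairing_mulPairing _ _) r.1 r.2 n h).compl₁₂
        ((HomologicalComplex.homologyMap (refineComplexMap (fun c : ι ×ₗ ι => (ofLex c).1)
          (pullbackSystemHom p 𝓤 (fun c : ι ×ₗ ι => p ⁻¹ᵁ 𝓤 (ofLex c).1 ⊓ q ⁻¹ᵁ 𝓤 (ofLex c).2) (fun c => (ofLex c).1) admp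
            ρX ρZ hρZp)) (r.1 : ℤ)).hom)
        ((HomologicalComplex.homologyMap (refineComplexMap (fun c : ι ×ₗ ι => (ofLex c).2)
          (pullbackSystemHom q 𝓤 (fun c : ι ×ₗ ι => p ⁻¹ᵁ 𝓤 (ofLex c).1 ⊓ q ⁻¹ᵁ 𝓤 (ofLex c).2) (fun c => (ofLex c).2) admq
            ρX ρZ hρZq)) (r.2 : ℤ)).hom)))
    (fun r h x => ?_) hΦ.1 T hT r hr
  -- the values on the summand `(r.1, r.2)`: §2 + (B-ii)
  exact comp_kunnethLinearEquiv_lof_eq (sectionsSystem 𝓤 (unitModule X) ρX) (sectionsSystem 𝓤 (unitModule X) ρX)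
    0 (Fintype.card ι : ℤ) 0 (Fintype.card ι : ℤ) (n : ℤ)
    ((HomologicalComplex.homologyMap e.hom (n : ℤ)).hom ∘ₗ
      (HomologicalComplex.homologyMap ((totalTensorIso (sectionsSystem 𝓤 (unitModule X) ρX)
          (sectionsSystem 𝓤 (unitModule X) ρX)).hom ≫
        totalDescHom (sysBicomplex (prodSystem (sectionsSystem 𝓤 (unitModule X) ρX) (sectionsSystem 𝓤 (unitModule X) ρX)))
          (sysComplex (lexSystem (prodSystem (sectionsSystem 𝓤 (unitModule X) ρX) (sectionsSystem 𝓤 (unitModule X) ρX))))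
          (fun a b n => ModuleCat.ofHom (crossComponent
            (prodSystem (sectionsSystem 𝓤 (unitModule X) ρX) (sectionsSystem 𝓤 (unitModule X) ρX)) a b n))
          (crossComponent_comm _)) (n : ℤ)).hom)
    ⟨((r.1 : ℤ), (r.2 : ℤ)), KunnethComponents.natPair_mem_idx n h⟩ _
    (fun y z => by
      rw [LinearMap.comp_apply, TensorProduct.lift.tmul, LinearMap.compl₁₂_apply]
      exact homologyMap_cechUnit_iso_cross_kunnethComponent_eq_cupH hρZp hρZq 𝓤 𝓤 e ε he hε r.1 r.2 n h y z)
    x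

include H φ hρX hU hW in
/-- **(G3-surj), T-shape — Künneth SURJECTIVITY on the product cover**: in the setting of `hinjT_productCover`, every class of
`Ȟⁿ(W, 𝒪_Z)` is an antidiagonal sum `∑_{a+b=n} (y ⊗ z ↦ p^*y ∪ q^*z) (T (a, b))` (★ B-p21 `KunnethComponents.hsurjT_of_surjective`; the
negative-degree Čech cohomology vanishes).  The letter `stub_hsurjT` of the F-J3b skeleton (F0P1b-p02 (g2)).
[cite: StacksProject, Tag 0BEC] [cite: GortzWedhorn2023, Cor. 22.110] [cite: MumfordAV1970, §13 Cor. 2 (p. 129)] -/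
theorem hsurjT_productCover (n : ℕ) [Module.Finite k ((cechComplex W (unitModule Z) ρZ).homology (n : ℤ))]
    (z : (cechComplex W (unitModule Z) ρZ).homology (n : ℤ)) :
    ∃ T : ∀ r : ℕ × ℕ, (cechComplex 𝓤 (unitModule X) ρX).homology (r.1 : ℤ) ⊗[k] (cechComplex 𝓤 (unitModule X) ρX).homology (r.2 : ℤ),
      z = ∑ r ∈ antidiagonal n, if h : r.1 + r.2 = n then
        TensorProduct.lift ((cupH (mulPairing W ρZ) (isNaturalPairing_mulPairing _ _) r.1 r.2 n h).compl₁₂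
          ((HomologicalComplex.homologyMap (refineComplexMap (fun c : ι ×ₗ ι => (ofLex c).1)
            (pullbackSystemHom p 𝓤 W (fun c => (ofLex c).1) admp ρX ρZ hρZp)) (r.1 : ℤ)).hom)
          ((HomologicalComplex.homologyMap (refineComplexMap (fun c : ι ×ₗ ι => (ofLex c).2)
            (pullbackSystemHom q 𝓤 W (fun c => (ofLex c).2) admq ρX ρZ hρZq)) (r.2 : ℤ)).hom)) (T r) else 0 := by
  classical
  obtain rfl : W = fun c : ι ×ₗ ι => p ⁻¹ᵁ 𝓤 (ofLex c).1 ⊓ q ⁻¹ᵁ 𝓤 (ofLex c).2 := funext fun c => hW (ofLex c).1 (ofLex c).2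
  obtain ⟨e, ε, he, hε⟩ := exists_sysComplex_lexSystem_prodSystem_iso_cechComplex_unit (H := H) (φ := φ) (hρX := hρX)
    (hρY := hρX) (hρZ := hρZp) 𝓤 𝓤 hU hU
  haveI := isStrictlyGE_cechComplex 𝓤 (unitModule X) ρX
  haveI := isStrictlyLE_cechComplex 𝓤 (unitModule X) ρX (Fintype.card ι : ℤ) (by omega)
  have hΦ := bijective_homologyMap_comp_kunnethLinearEquiv (sectionsSystem 𝓤 (unitModule X) ρX)
    (sectionsSystem 𝓤 (unitModule X) ρX) e 0 (Fintype.card ι : ℤ) 0 (Fintype.card ι : ℤ) (n : ℤ)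
  have hneg : ∀ i : ℤ, i < 0 → Subsingleton ((fun i : ℤ => ((cechComplex 𝓤 (unitModule X) ρX).homology i : Type u)) i) :=
    fun i hi => ModuleCat.subsingleton_of_isZero (ShortComplex.isZero_homology_of_isZero_X₂ _
      (OrderedCech.isZero_sysComplex_X_of_neg (sectionsSystem 𝓤 (unitModule X) ρX) i hi))
  refine KunnethComponents.hsurjT_of_surjective (HZ := fun i : ℤ => ((cechComplex 𝓤 (unitModule X) ρX).homology i : Type u)) n _
    (fun r h => TensorProduct.lift ((cupH (mulPairing (fun c : ι ×ₗ ι => p ⁻¹ᵁ 𝓤 (ofLex c).1 ⊓ q ⁻¹ᵁ 𝓤 (ofLex c).2) ρZ)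
      (isNaturalPairing_mulPairing _ _) r.1 r.2 n h).compl₁₂
        ((HomologicalComplex.homologyMap (refineComplexMap (fun c : ι ×ₗ ι => (ofLex c).1)
          (pullbackSystemHom p 𝓤 (fun c : ι ×ₗ ι => p ⁻¹ᵁ 𝓤 (ofLex c).1 ⊓ q ⁻¹ᵁ 𝓤 (ofLex c).2) (fun c => (ofLex c).1) admp
            ρX ρZ hρZp)) (r.1 : ℤ)).hom)
        ((HomologicalComplex.homologyMap (refineComplexMap (fun c : ι ×ₗ ι => (ofLex c).2)
          (pullbackSystemHom q 𝓤 (fun c : ι ×ₗ ι => p ⁻¹ᵁ 𝓤 (ofLex c).1 ⊓ q ⁻¹ᵁ 𝓤 (ofLex c).2) (fun c => (ofLex c).2) admq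
            ρX ρZ hρZq)) (r.2 : ℤ)).hom)))
    (fun r h x => ?_) hneg hΦ.2 z
  exact comp_kunnethLinearEquiv_lof_eq (sectionsSystem 𝓤 (unitModule X) ρX) (sectionsSystem 𝓤 (unitModule X) ρX)
    0 (Fintype.card ι : ℤ) 0 (Fintype.card ι : ℤ) (n : ℤ)
    ((HomologicalComplex.homologyMap e.hom (n : ℤ)).hom ∘ₗ
      (HomologicalComplex.homologyMap ((totalTensorIso (sectionsSystem 𝓤 (unitModule X) ρX)
          (sectionsSystem 𝓤 (unitModule X) ρX)).hom ≫
        totalDescHom (sysBicomplex (prodSystem (sectionsSystem 𝓤 (unitModule X) ρX) (sectionsSystem 𝓤 (unitModule X) ρX)))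
          (sysComplex (lexSystem (prodSystem (sectionsSystem 𝓤 (unitModule X) ρX) (sectionsSystem 𝓤 (unitModule X) ρX))))
          (fun a b n => ModuleCat.ofHom (crossComponent
            (prodSystem (sectionsSystem 𝓤 (unitModule X) ρX) (sectionsSystem 𝓤 (unitModule X) ρX)) a b n))
          (crossComponent_comm _)) (n : ℤ)).hom)
    ⟨((r.1 : ℤ), (r.2 : ℤ)), KunnethComponents.natPair_mem_idx n h⟩ _
    (fun y z => by
      rw [LinearMap.comp_apply, TensorProduct.lift.tmul, LinearMap.compl₁₂_apply]
      exact homologyMap_cechUnit_iso_cross_kunnethComponent_eq_cupH hρZp hρZq 𝓤 𝓤 e ε he hε r.1 r.2 n h y z)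
    x

end ProductCover

end Literature.AlgebraicGeometry.Modules

end
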